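import Summits.Ventures.HodgeRepro.BallGen

/-!
# Invariance bookkeeping for Lemma W on the `p`-ball, every `p` (seat p5)

Blind re-derivation cell `pub-hodge-repro`, seat `p5`.  Built on typer-2's general-`p` ball model
`BallGen.lean` (`U p = U(p,1)`, `Ball p`, `act`, `Jac`, `pullback`, chain rule `Jac_mul`).  Mathlib otherwise.

The general-`p` companion of `BallInvariance.lean`: the route's Lemma W (ROUTE.md Appendix A4) produces
translates `g_i^*ω_i` of `Γ`-invariant holomorphic `1`-forms with a non-zero wedge at a point, and reads
the `g`-form `g_1^*ω_1 ∧ ⋯ ∧ g_g^*ω_g` as a form on the finite cover `Γ″\𝔹^p`,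
`Γ″ = Γ ∩ ⋂_i g_i⁻¹ Γ g_i`.  Here, with `pullback γ F := z ↦ J_γ(z)ᵀ F(γ z)`:

* `pullback_one`, `pullback_mul'`, `pullback_inv_pullback` — `pullback` is a right action of `U(p,1)`;
* `IsInvariant Γ F`, `conjSub g Γ = g⁻¹ Γ g`, `isInvariant_pullback_conj` — a `Γ`-invariant field has
  `g⁻¹ Γ g`-invariant translate;
* `topForm ω z = det (ω_i(z))_i` — the coefficient of the `(p,0)`-form `ω_1 ∧ ⋯ ∧ ω_p`;
* `pullTop γ f z = det J_γ(z) · f(γ z)` — the pull-back of a `(p,0)`-form; `pullTop_topForm`: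
  `γ^*(ω_1 ∧ ⋯ ∧ ω_p) = γ^*ω_1 ∧ ⋯ ∧ γ^*ω_p`;
* `isInvariantTop_topForm_pullback` — **the A4 bookkeeping**: for `Γ`-invariant `ω_i` and any
  `g_i ∈ U(p,1)`, the `(p,0)`-form `⋀_i g_i^*ω_i` is invariant under `⨅ i, g_i⁻¹ Γ g_i`;
* `topForm_ne_zero_iff_linearIndependent` — non-vanishing of the top form at `z` is linear independence of
  the `p` covectors there (the conclusion of typer-2's `lemmaW_iter` / p5's `lemmaW_generic`).

The finite-index statement (`⨅ i, g_i⁻¹ Γ g_i` has finite index in a congruence `Γ` for rational `g_i`)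
is NOT formalised here.  Nothing here says anything about the status of the Hodge conjecture for CM
abelian varieties.
-/

set_option autoImplicit false

noncomputable section

namespace HodgeRepro.BallGen

namespace Inv

open Matrix

variable {p : ℕ}

/-! ### The translate as a right action -/

/-- The identity translates nothing. -/
theorem pullback_one (F : Ball p → Fin p → ℂ) : pullback 1 F = F := by
  funext z
  simp [pullback, Jac_one, act_one]

/-- Chain rule for translates, as an equality of fields: `pullback (g * h) F = pullback h (pullback g F)`. -/
theorem pullback_mul' (g h : U p) (F : Ball p → Fin p → ℂ) :
    pullback (g * h) F = pullback h (pullback g F) :=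
  funext fun z => pullback_mul g h F z

/-- Translating by `g` and then by `g⁻¹` gives the field back. -/
theorem pullback_inv_pullback (g : U p) (F : Ball p → Fin p → ℂ) : pullback g⁻¹ (pullback g F) = F := by
  rw [← pullback_mul', mul_inv_cancel, pullback_one]

/-- Translating by `g⁻¹` and then by `g` gives the field back. -/
theorem pullback_pullback_inv (g : U p) (F : Ball p → Fin p → ℂ) : pullback g (pullback g⁻¹ F) = F := by
  rw [← pullback_mul', inv_mul_cancel, pullback_one]

/-- The translate of the zero field is zero. -/
theorem pullback_zero (γ : U p) : pullback γ (0 : Ball p → Fin p → ℂ) = 0 := by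
  funext z
  simp [pullback]

/-- A translate vanishes identically iff the field does. -/
theorem pullback_eq_zero_iff (γ : U p) (F : Ball p → Fin p → ℂ) : pullback γ F = 0 ↔ F = 0 := by
  constructor
  · intro h
    rw [← pullback_inv_pullback γ F, h, pullback_zero]
  · rintro rfl
    exact pullback_zero γ

/-! ### Invariant fields and conjugate subgroups -/

/-- A cotangent field invariant under a subgroup `Γ ≤ U(p,1)`: `pullback γ F = F` for every `γ ∈ Γ`. -/
def IsInvariant (Γ : Subgroup (U p)) (F : Ball p → Fin p → ℂ) : Prop := ∀ γ ∈ Γ, pullback γ F = F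

/-- Invariance passes to smaller subgroups. -/
theorem IsInvariant.mono {Γ Γ' : Subgroup (U p)} (h : Γ' ≤ Γ) {F : Ball p → Fin p → ℂ}
    (hF : IsInvariant Γ F) : IsInvariant Γ' F :=
  fun γ hγ => hF γ (h hγ)

/-- The conjugate subgroup `g⁻¹ Γ g = {δ : g δ g⁻¹ ∈ Γ}`. -/
def conjSub (g : U p) (Γ : Subgroup (U p)) : Subgroup (U p) := Γ.comap (MulAut.conj g).toMonoidHom

/-- `δ ∈ g⁻¹ Γ g ↔ g δ g⁻¹ ∈ Γ`. -/
theorem mem_conjSub {g : U p} {Γ : Subgroup (U p)} {δ : U p} :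
    δ ∈ conjSub g Γ ↔ g * δ * g⁻¹ ∈ Γ := Iff.rfl

/-- `g⁻¹ Γ g` contains `g⁻¹ γ g` for every `γ ∈ Γ`. -/
theorem inv_mul_mul_mem_conjSub {g : U p} {Γ : Subgroup (U p)} {γ : U p} (hγ : γ ∈ Γ) :
    g⁻¹ * γ * g ∈ conjSub g Γ := by
  rw [mem_conjSub]
  have : g * (g⁻¹ * γ * g) * g⁻¹ = γ := by group
  rw [this]
  exact hγ

/-- Conjugating by the identity changes nothing. -/
theorem conjSub_one (Γ : Subgroup (U p)) : conjSub 1 Γ = Γ := by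
  ext δ
  rw [mem_conjSub]
  simp

/-- **A `Γ`-invariant field has `g⁻¹ Γ g`-invariant translate** `pullback g F`. -/
theorem isInvariant_pullback_conj {Γ : Subgroup (U p)} {F : Ball p → Fin p → ℂ} (hF : IsInvariant Γ F)
    (g : U p) : IsInvariant (conjSub g Γ) (pullback g F) := by
  intro δ hδ
  rw [mem_conjSub] at hδ
  calc pullback δ (pullback g F) = pullback (g * δ) F := (pullback_mul' g δ F).symm
    _ = pullback (g * δ * g⁻¹ * g) F := by rw [inv_mul_cancel_right]
    _ = pullback g (pullback (g * δ * g⁻¹) F) := pullback_mul' _ _ _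
    _ = pullback g F := by rw [hF _ hδ]

/-! ### `(p,0)`-forms, their pull-backs and the A4 bookkeeping -/

/-- The `(p,0)`-form `ω_1 ∧ ⋯ ∧ ω_p` of `p` cotangent fields: its coefficient `det (ω_i(z))_i` on
`dz_1 ∧ ⋯ ∧ dz_p` (rows = the covectors). -/
def topForm (ω : Fin p → Ball p → Fin p → ℂ) (z : Ball p) : ℂ := (Matrix.of fun i => ω i z).det

/-- The pull-back of a `(p,0)`-form `f(z) dz_1 ∧ ⋯ ∧ dz_p` by `γ`: `(γ^*f)(z) = det J_γ(z) · f(γ z)`. -/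
def pullTop (γ : U p) (f : Ball p → ℂ) (z : Ball p) : ℂ := (Jac γ z).det * f (act γ z)

/-- The identity pulls back nothing. -/
theorem pullTop_one (f : Ball p → ℂ) : pullTop 1 f = f := by
  funext z
  simp [pullTop, Jac_one, act_one]

/-- Chain rule for pull-backs of `(p,0)`-forms: `pullTop (g * h) f = pullTop h (pullTop g f)`. -/
theorem pullTop_mul (g h : U p) (f : Ball p → ℂ) : pullTop (g * h) f = pullTop h (pullTop g f) := by
  funext z
  simp only [pullTop, Jac_mul, ← act_mul, Matrix.det_mul]
  ring

/-- The matrix of `p` translated covectors is the matrix of the covectors at `γ z` times `J_γ(z)`. -/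
theorem of_pullback_eq_mul (γ : U p) (ω : Fin p → Ball p → Fin p → ℂ) (z : Ball p) :
    (Matrix.of fun i => pullback γ (ω i) z) = (Matrix.of fun i => ω i (act γ z)) * Jac γ z := by
  ext i j
  simp only [Matrix.of_apply, pullback, Matrix.mulVec, dotProduct, Matrix.transpose_apply,
    Matrix.mul_apply]
  exact Finset.sum_congr rfl fun k _ => mul_comm _ _

/-- `γ^*(ω_1 ∧ ⋯ ∧ ω_p) = γ^*ω_1 ∧ ⋯ ∧ γ^*ω_p`. -/
theorem pullTop_topForm (γ : U p) (ω : Fin p → Ball p → Fin p → ℂ) :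
    pullTop γ (topForm ω) = topForm fun i => pullback γ (ω i) := by
  funext z
  simp only [pullTop, topForm, of_pullback_eq_mul, Matrix.det_mul]
  ring

/-- A `(p,0)`-form invariant under a subgroup `Γ ≤ U(p,1)`. -/
def IsInvariantTop (Γ : Subgroup (U p)) (f : Ball p → ℂ) : Prop := ∀ γ ∈ Γ, pullTop γ f = f

/-- Invariance of top forms passes to smaller subgroups. -/
theorem IsInvariantTop.mono {Γ Γ' : Subgroup (U p)} (h : Γ' ≤ Γ) {f : Ball p → ℂ}
    (hf : IsInvariantTop Γ f) : IsInvariantTop Γ' f :=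
  fun γ hγ => hf γ (h hγ)

/-- The wedge of `p` `Γ`-invariant fields is a `Γ`-invariant `(p,0)`-form. -/
theorem isInvariantTop_topForm {Γ : Subgroup (U p)} {ω : Fin p → Ball p → Fin p → ℂ}
    (hω : ∀ i, IsInvariant Γ (ω i)) : IsInvariantTop Γ (topForm ω) := by
  intro γ hγ
  rw [pullTop_topForm]
  congr 1
  funext i
  exact hω i γ hγ

/-- **The A4 bookkeeping (Lemma W, iterated).**  For `Γ`-invariant fields `ω_i` and any `g_i ∈ U(p,1)`,
the `(p,0)`-form `g_1^*ω_1 ∧ ⋯ ∧ g_p^*ω_p` is invariant under `⨅ i, g_i⁻¹ Γ g_i`. -/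
theorem isInvariantTop_topForm_pullback {Γ : Subgroup (U p)} {ω : Fin p → Ball p → Fin p → ℂ}
    (hω : ∀ i, IsInvariant Γ (ω i)) (g : Fin p → U p) :
    IsInvariantTop (⨅ i, conjSub (g i) Γ) (topForm fun i => pullback (g i) (ω i)) :=
  isInvariantTop_topForm fun i => (isInvariant_pullback_conj (hω i) (g i)).mono (iInf_le _ i)

/-- The pull-back of a top form vanishes at `z` iff the form vanishes at `γ z` (`det J_γ(z) ≠ 0`). -/
theorem pullTop_eq_zero_iff (γ : U p) (f : Ball p → ℂ) (z : Ball p) :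
    pullTop γ f z = 0 ↔ f (act γ z) = 0 := by
  simp [pullTop, det_Jac_ne_zero]

/-- The non-vanishing set of a `Γ`-invariant top form is stable under `Γ`. -/
theorem IsInvariantTop.ne_zero_act {Γ : Subgroup (U p)} {f : Ball p → ℂ} (hf : IsInvariantTop Γ f)
    {γ : U p} (hγ : γ ∈ Γ) {z : Ball p} (hz : f z ≠ 0) : f (act γ z) ≠ 0 := by
  intro h
  apply hz
  have h1 : pullTop γ f z = f z := congrFun (hf γ hγ) z
  rw [← h1, pullTop, h, mul_zero]

/-- The top form is non-zero at `z` iff the `p` covectors `ω_i(z)` are linearly independent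
(rows of a square matrix: `Matrix.linearIndependent_rows_iff_isUnit`). -/
theorem topForm_ne_zero_iff_linearIndependent (ω : Fin p → Ball p → Fin p → ℂ) (z : Ball p) :
    topForm ω z ≠ 0 ↔ LinearIndependent ℂ fun i => ω i z := by
  rw [topForm, ← isUnit_iff_ne_zero, ← Matrix.isUnit_iff_isUnit_det,
    ← Matrix.linearIndependent_rows_iff_isUnit]
  rfl

/-- **From Lemma W to an invariant form.**  If the `ω_i` are `Γ`-invariant and the translated
covectors `(g_i^*ω_i)(z)` are linearly independent at one point `z` (the conclusion of Lemma W), then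
`⋀_i g_i^*ω_i` is a NON-ZERO `⨅ i, g_i⁻¹ Γ g_i`-invariant `(p,0)`-form on the ball. -/
theorem exists_invariantTop_topForm_ne_zero {Γ : Subgroup (U p)} {ω : Fin p → Ball p → Fin p → ℂ}
    (hω : ∀ i, IsInvariant Γ (ω i)) (g : Fin p → U p) {z : Ball p}
    (h : LinearIndependent ℂ fun i => pullback (g i) (ω i) z) :
    IsInvariantTop (⨅ i, conjSub (g i) Γ) (topForm fun i => pullback (g i) (ω i)) ∧
      (topForm fun i => pullback (g i) (ω i)) ≠ 0 := by
  refine ⟨isInvariantTop_topForm_pullback hω g, ?_⟩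
  intro h0
  have hz : (topForm fun i => pullback (g i) (ω i)) z ≠ 0 :=
    (topForm_ne_zero_iff_linearIndependent _ z).mpr h
  exact hz (by rw [h0]; rfl)

end Inv

end HodgeRepro.BallGen

end
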